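import Summits.ValiantsHypothesis.ValiantsHypothesis.Theorems.KPlusLogSqLawStaticPathOpt

/-!
# Route «KPlusLogSqLaw» — block optima on a path read from the right: the right train is a left train

HONEST FRAMING.  Helper toward the crux `WeakLifting` (item `stmt-ValiantsHypothesis-19561`, route `KPlusLogSqLaw`, cell `pub-symmetroid`,
seat val-sym-lift-p3 g6, 2026-08-27) on the line of its witness-plan stub `stub_tridiagonalSectorB` (tropical twin of the STATIC tridiagonal
sector = parametric max-weight independent set on a path, val-sym-lift-p4 g6 `HOME/val-sym-lift-p4/STATIC-PATH-NLOGN.md`).  Reflecting the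
block of items `j+1, …, j+l` (`t ↦ j + l + 1 - t`) preserves independence and total weight, so the optimum of its right end segment of length
`k` equals the optimum of the first `k` reflected items (`opt_reflect`); consequently the RIGHT TRAIN «block minus block-without-its-first-item»
is the LEFT TRAIN of the reflected items (`opt_sub_first_eq_Δ`) — so the degeneracy-free fold lemma certifies it too (part 4, `pa_train`).
Statements about a path DP; nothing here asserts anything about `WeakLifting`, `TropicalB`, `KPlusLogSqLaw`, the stub in its window,
`MatrixDescartes` (stmt-ValiantsHypothesis-18050) or `VP ≠ VNP`.
-/

set_option linter.dupNamespace false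
set_option autoImplicit false

namespace Summit.ValiantsHypothesis.ValiantsHypothesis.Theorems.KPlusLogSqLaw

open Finset Classical

namespace StaticPathFold

noncomputable section

variable (w₁ w₀ : ℕ → ℝ)

/-- the reflected item lines: `W (rev j l w₁) (rev j l w₀) t = W w₁ w₀ (j + l + 1 - t)`. [folklore] -/
theorem W_rev (j l t : ℕ) (θ : ℝ) : W (rev j l w₁) (rev j l w₀) t θ = W w₁ w₀ (j + l + 1 - t) θ := rfl

/-- reflection maps an independent subset of the first `k` reflected items onto an independent subset of the last `k` items of the
block, with the same total weight. [folklore] -/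
theorem image_reflect_mem {j l k : ℕ} (hk : k ≤ l) {S : Finset ℕ} (hS : S ∈ indepSets 0 k) :
    S.image (fun t => j + l + 1 - t) ∈ indepSets (j + (l - k)) k ∧
      ∀ θ, ∑ t ∈ S.image (fun t => j + l + 1 - t), W w₁ w₀ t θ = ∑ t ∈ S, W (rev j l w₁) (rev j l w₀) t θ := by
  rcases mem_indepSets.mp hS with ⟨hS1, hS2⟩
  have hbd : ∀ t ∈ S, 1 ≤ t ∧ t ≤ k := fun t ht => by have := mem_Ioc.mp (hS1 ht); omega
  have hinj : Set.InjOn (fun t => j + l + 1 - t) ↑S := by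
    intro a ha b hb hab
    have := hbd a ha; have := hbd b hb
    simp only at hab; omega
  refine ⟨mem_indepSets.mpr ⟨fun t ht => ?_, fun t ht ht1 => ?_⟩, fun θ => ?_⟩
  · obtain ⟨a, ha, rfl⟩ := mem_image.mp ht
    have := hbd a ha
    rw [mem_Ioc]; omega
  · obtain ⟨a, ha, hat⟩ := mem_image.mp ht
    obtain ⟨b, hb, hbt⟩ := mem_image.mp ht1
    have := hbd a ha; have := hbd b hb
    -- `b = a - 1`, so `b + 1 = a ∈ S` with `b ∈ S`: not independent
    have hba : b + 1 = a := by omega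
    exact hS2 b hb (hba ▸ ha)
  · rw [sum_image hinj]
    rfl

/-- the inverse direction: an independent subset of the last `k` items reflects onto an independent subset of the first `k` reflected
items, with the same total weight. [folklore] -/
theorem image_reflect_mem' {j l k : ℕ} (hk : k ≤ l) {S : Finset ℕ} (hS : S ∈ indepSets (j + (l - k)) k) :
    S.image (fun t => j + l + 1 - t) ∈ indepSets 0 k ∧
      ∀ θ, ∑ t ∈ S.image (fun t => j + l + 1 - t), W (rev j l w₁) (rev j l w₀) t θ = ∑ t ∈ S, W w₁ w₀ t θ := by
  rcases mem_indepSets.mp hS with ⟨hS1, hS2⟩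
  have hbd : ∀ t ∈ S, j + (l - k) + 1 ≤ t ∧ t ≤ j + l := fun t ht => by have := mem_Ioc.mp (hS1 ht); omega
  have hinj : Set.InjOn (fun t => j + l + 1 - t) ↑S := by
    intro a ha b hb hab
    have := hbd a ha; have := hbd b hb
    simp only at hab; omega
  refine ⟨mem_indepSets.mpr ⟨fun t ht => ?_, fun t ht ht1 => ?_⟩, fun θ => ?_⟩
  · obtain ⟨a, ha, rfl⟩ := mem_image.mp ht
    have := hbd a ha
    rw [mem_Ioc]; omega
  · obtain ⟨a, ha, hat⟩ := mem_image.mp ht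
    obtain ⟨b, hb, hbt⟩ := mem_image.mp ht1
    have := hbd a ha; have := hbd b hb
    have hba : b + 1 = a := by omega
    exact hS2 b hb (hba ▸ ha)
  · rw [sum_image hinj]
    refine sum_congr rfl fun t ht => ?_
    have := hbd t ht
    show W w₁ w₀ (j + l + 1 - (j + l + 1 - t)) θ = W w₁ w₀ t θ
    congr 1; omega

/-- **reflection**: the optimum of the last `k` items of the block `j+1..j+l` equals the optimum of the first `k` reflected items. [folklore] -/
theorem opt_reflect (j l k : ℕ) (hk : k ≤ l) (θ : ℝ) :
    opt w₁ w₀ (j + (l - k)) k θ = opt (rev j l w₁) (rev j l w₀) 0 k θ := by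
  apply le_antisymm
  · refine opt_le w₁ w₀ fun S hS => ?_
    obtain ⟨hmem, hsum⟩ := image_reflect_mem' w₁ w₀ hk hS
    rw [← hsum θ]
    exact sum_le_opt _ _ hmem θ
  · refine opt_le _ _ fun S hS => ?_
    obtain ⟨hmem, hsum⟩ := image_reflect_mem w₁ w₀ (j := j) hk hS
    rw [← hsum θ]
    exact sum_le_opt w₁ w₀ hmem θ

/-- **the right train is a left train**: «block minus block-without-its-first-item» equals the left train of the reflected items:
`opt j (k+1) - opt (j+1) k = Δ (shift 0 (rev j (k+1))) (k+1)`. [folklore] -/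
theorem opt_sub_first_eq_Δ (j k : ℕ) (θ : ℝ) :
    opt w₁ w₀ j (k + 1) θ - opt w₁ w₀ (j + 1) k θ =
      Δ (shift 0 (rev j (k + 1) w₁)) (shift 0 (rev j (k + 1) w₀)) (k + 1) θ := by
  have h1 := opt_reflect w₁ w₀ j (k + 1) (k + 1) le_rfl θ
  have h2 := opt_reflect w₁ w₀ j (k + 1) k (Nat.le_succ k) θ
  rw [Nat.sub_self, Nat.add_zero] at h1
  rw [Nat.add_sub_cancel_left] at h2
  rw [h1, h2]
  exact opt_sub_eq_Δ _ _ 0 k θ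

end

end StaticPathFold

end Summit.ValiantsHypothesis.ValiantsHypothesis.Theorems.KPlusLogSqLaw
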